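import Summits.MatrixMultiplication.OmegaCensus.DicyclicN1Dichotomy
import Summits.MatrixMultiplication.OmegaCensus.DominoStructureTPP
import HarnessLib

/-!
# Class N1 of the dicyclic law, part 3: the near-tiling in `A/⟨c₀⟩` and the four cosets

ω-census `pub-omega`, family (b3), seat pub-omega-group gen 12.  Framing: lottery ticket; floor = certified bounds/negative
ranges.  VALUE: kernel theorem for the structure theory of TPP triples in dicyclic-type groups; NOT progress on ω.

Continuation of `DicyclicN1Dichotomy.lean` (same additive data: `π : A →+ B` onto with kernel `{0, c₀}`, `B` a `2`-group,
`U₀, U₁ ⊆ A`, differences `e₀, e₁`, the tilings (T1), (T2), the periodicity of the four pair-sets `U_l ⊔ (U_l + e_j)` and the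
packing inclusion (F) with `y = α₁ + α₂ − 2α₃ + e₀ − e₁ + c₀`).

* Projection lemmas: a `c₀`-periodic subset of `A` has a `π`-image of half its size, disjoint periodic sets have disjoint
  images, `2|B| = |A|`.
* **`n1_four_cosets`**: by `n1_dichotomy`, `π e₁ = ±π e₀` or one of them vanishes; in each case the images
  `X̄ = π(U₀ ⊔ U₀+e₀)` and `π(U₀ ⊔ U₀+e₁)` differ by a translation `ε` with `X̄ + (π e₁ − π e₀ − 2ε) = X̄`, so (T1) projects to
  a near-tiling `B = P ⊔ (P + e) ⊔ C` with `|P| = |C| + 2` and (F) gives `C ⊆ P + 2e`; `two_cosets_of_three_pieces`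
  (`DihedralLawModOneShapeBLemmas.lean`) makes `B` two cosets of `⟨e⟩`, hence **`A` is covered by the four cosets
  `{0, z, c₀, z + c₀} + ⟨g⟩`** — exactly the hypothesis of `psi_not_onto_of_four_cosets` (`DicyclicLawReduction.lean`):
  no three homomorphisms `A →+ ZMod 2` killing `c₀` are jointly onto `𝔽₂³`.
The TPP bookkeeping (an N1-class dicyclic-law triple yields this data) is `DicyclicN1Law.lean`.
-/

namespace Summit.MatrixMultiplication.OmegaCensus

open Finset

section Projection

variable {A : Type} [AddCommGroup A] [Fintype A] [DecidableEq A] {B : Type} [AddCommGroup B] [Fintype B]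
  [DecidableEq B]

omit [Fintype A] [Fintype B] in
/-- Images of translates are translates of images. [folklore] -/
theorem image_pi_image_add (π : A →+ B) (X : Finset A) (a : A) :
    (X.image (· + a)).image π = (X.image π).image (· + π a) := by
  rw [image_image, image_image]
  exact image_congr fun x _ => by simp

omit [Fintype A] in
/-- A translate of a pair-set `U ⊔ (U + e)`. [folklore] -/
theorem pair_translate (U : Finset A) (e α : A) :
    (U ∪ U.image (· + e)).image (· + α) = U.image (· + α) ∪ U.image (· + (α + e)) := by
  rw [image_union, image_add_image, add_comm e α]

omit [Fintype A] in
/-- Translates of periodic sets are periodic. [folklore] -/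
theorem periodic_translate {X : Finset A} {c₀ : A} (hper : X.image (· + c₀) = X) (α : A) :
    (X.image (· + α)).image (· + c₀) = X.image (· + α) := by
  rw [image_add_image, add_comm α c₀, ← image_add_image, hper]

omit [Fintype A] [Fintype B] in
/-- **A `c₀`-periodic set projects onto a set of half its size** (`ker π = {0, c₀}`, `c₀ ≠ 0`). [folklore] -/
theorem two_mul_card_image_pi (π : A →+ B) {c₀ : A} (hker : ∀ a : A, π a = 0 ↔ a = 0 ∨ a = c₀) (hc₀ : c₀ ≠ 0)
    {X : Finset A} (hper : X.image (· + c₀) = X) : 2 * (X.image π).card = X.card := by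
  have hπc : π c₀ = 0 := (hker c₀).2 (Or.inr rfl)
  have hmem : ∀ x ∈ X, x + c₀ ∈ X := fun x hx => by rw [← hper]; exact mem_image_of_mem _ hx
  rw [card_eq_sum_card_fiberwise (f := π) (s := X) (t := X.image π) fun x hx => mem_image_of_mem _ hx]
  have hfib : ∀ b ∈ X.image π, (X.filter fun x => π x = b).card = 2 := by
    intro b hb
    obtain ⟨x, hx, rfl⟩ := mem_image.1 hb
    have hne : x ≠ x + c₀ := fun h => hc₀ (left_eq_add.1 h)
    rw [← card_pair hne]
    congr 1
    ext z
    rw [mem_filter, mem_insert, mem_singleton]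
    constructor
    · rintro ⟨-, hz⟩
      rcases (hker (z - x)).1 (by rw [map_sub, hz, sub_self]) with h | h
      · exact Or.inl (sub_eq_zero.1 h)
      · exact Or.inr (by rw [← h]; abel)
    · rintro (rfl | rfl)
      · exact ⟨hx, rfl⟩
      · exact ⟨hmem x hx, by rw [map_add, hπc, add_zero]⟩
  rw [sum_congr rfl hfib, sum_const, smul_eq_mul, mul_comm]

omit [Fintype A] [Fintype B] in
/-- **Disjoint periodic sets have disjoint projections.** [folklore] -/
theorem disjoint_image_pi (π : A →+ B) {c₀ : A} (hker : ∀ a : A, π a = 0 ↔ a = 0 ∨ a = c₀) {X Y : Finset A}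
    (hY : Y.image (· + c₀) = Y) (h : Disjoint X Y) : Disjoint (X.image π) (Y.image π) := by
  rw [disjoint_left]
  intro b hbX hbY
  obtain ⟨x, hx, rfl⟩ := mem_image.1 hbX
  obtain ⟨z, hz, hzx⟩ := mem_image.1 hbY
  rcases (hker (x - z)).1 (by rw [map_sub, hzx, sub_self]) with h' | h'
  · exact disjoint_left.1 h hx (by rw [sub_eq_zero.1 h']; exact hz)
  · have : z + c₀ ∈ Y := by rw [← hY]; exact mem_image_of_mem _ hz
    exact disjoint_left.1 h hx (by rw [← sub_add_cancel x z, h', add_comm]; exact this)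

omit [Fintype B] in
/-- `2|π(A)| = |A|` for `π` with kernel `{0, c₀}`, `c₀ ≠ 0` (so `2|B| = |A|` when `π` is onto, `image_pi_univ`).
[folklore] -/
theorem two_mul_card_quot (π : A →+ B) {c₀ : A}
    (hker : ∀ a : A, π a = 0 ↔ a = 0 ∨ a = c₀) (hc₀ : c₀ ≠ 0) :
    2 * ((univ : Finset A).image π).card = Fintype.card A := by
  have hper : (univ : Finset A).image (· + c₀) = univ :=
    eq_univ_of_forall fun x => mem_image.2 ⟨x - c₀, mem_univ _, sub_add_cancel x c₀⟩
  rw [two_mul_card_image_pi π hker hc₀ hper, card_univ]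

omit [Fintype A] [DecidableEq A] in
/-- `univ.image π = univ` for `π` onto. [folklore] -/
theorem image_pi_univ [Fintype A] [DecidableEq A] (π : A →+ B) (hπ : Function.Surjective π) :
    (univ : Finset A).image π = univ :=
  eq_univ_of_forall fun b => by obtain ⟨a, rfl⟩ := hπ b; exact mem_image_of_mem _ (mem_univ a)

end Projection

section N1Cosets

variable {A : Type} [AddCommGroup A] [Fintype A] [DecidableEq A] {B : Type} [AddCommGroup B] [Fintype B]
  [DecidableEq B]

/-- **The N1 data force four cosets of a cyclic subgroup.**  Under the hypotheses of `n1_dichotomy` together with the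
periodicity of all four pair-sets `U_l ⊔ (U_l + e_j)` and `y = α₁ + α₂ − 2α₃ + e₀ − e₁ + c₀`, there are `g, z ∈ A` with
`A ⊆ ⟨g⟩ ∪ (z + ⟨g⟩) ∪ (c₀ + ⟨g⟩) ∪ (z + c₀ + ⟨g⟩)` (written as in `psi_not_onto_of_four_cosets`). [folklore] -/
theorem n1_four_cosets (π : A →+ B) (hπ : Function.Surjective π) {c₀ : A}
    (hker : ∀ a : A, π a = 0 ↔ a = 0 ∨ a = c₀) (hc₀ : c₀ ≠ 0) {m : ℕ} (hB : ∀ b : B, (2 ^ m) • b = 0)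
    {U₀ U₁ : Finset A} {e₀ e₁ α₁ α₂ α₃ β₁ β₂ β₃ y : A}
    (hU₀e₀ : Disjoint U₀ (U₀.image (· + e₀))) (hU₀e₁ : Disjoint U₀ (U₀.image (· + e₁)))
    (hU₁e₀ : Disjoint U₁ (U₁.image (· + e₀))) (hU₁e₁ : Disjoint U₁ (U₁.image (· + e₁)))
    (hcard : U₀.card = U₁.card + 2) (hA : Fintype.card A = 4 * U₀.card + 2 * U₁.card)
    (h12 : Disjoint (U₀.image (· + α₁) ∪ U₀.image (· + (α₁ + e₀))) (U₁.image (· + α₂) ∪ U₁.image (· + (α₂ + e₀))))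
    (h13 : Disjoint (U₀.image (· + α₁) ∪ U₀.image (· + (α₁ + e₀))) (U₀.image (· + α₃) ∪ U₀.image (· + (α₃ + e₁))))
    (h23 : Disjoint (U₁.image (· + α₂) ∪ U₁.image (· + (α₂ + e₀))) (U₀.image (· + α₃) ∪ U₀.image (· + (α₃ + e₁))))
    (k12 : Disjoint (U₀.image (· + β₁) ∪ U₀.image (· + (β₁ + e₁))) (U₁.image (· + β₂) ∪ U₁.image (· + (β₂ + e₁))))
    (k13 : Disjoint (U₀.image (· + β₁) ∪ U₀.image (· + (β₁ + e₁))) (U₀.image (· + β₃) ∪ U₀.image (· + (β₃ + e₀))))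
    (k23 : Disjoint (U₁.image (· + β₂) ∪ U₁.image (· + (β₂ + e₁))) (U₀.image (· + β₃) ∪ U₀.image (· + (β₃ + e₀))))
    (hrel₁ : β₁ - β₂ = α₁ - α₂) (hrel₂ : β₃ - β₂ = α₃ - α₂ + e₁ - e₀ + c₀)
    (hrel₃ : y = α₁ + α₂ - α₃ - α₃ + e₀ - e₁ + c₀)
    (hp₀₀ : (U₀ ∪ U₀.image (· + e₀)).image (· + c₀) = U₀ ∪ U₀.image (· + e₀))
    (hp₀₁ : (U₁ ∪ U₁.image (· + e₀)).image (· + c₀) = U₁ ∪ U₁.image (· + e₀))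
    (hp₁₀ : (U₀ ∪ U₀.image (· + e₁)).image (· + c₀) = U₀ ∪ U₀.image (· + e₁))
    (hp₁₁ : (U₁ ∪ U₁.image (· + e₁)).image (· + c₀) = U₁ ∪ U₁.image (· + e₁))
    (hsub : U₁.image (· + y) ∪ U₁.image (· + (y + e₁)) ⊆ U₀ ∪ U₀.image (· + e₁)) :
    ∃ g z : A, ∀ x : A, x ∈ AddSubgroup.zmultiples g ∨ x - z ∈ AddSubgroup.zmultiples g ∨
      x + c₀ ∈ AddSubgroup.zmultiples g ∨ x + c₀ - z ∈ AddSubgroup.zmultiples g := by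
  have hπc : π c₀ = 0 := (hker c₀).2 (Or.inr rfl)
  have h2c : c₀ + c₀ = 0 := by
    rcases (hker (c₀ + c₀)).1 (by rw [map_add, hπc, add_zero]) with h | h
    · exact h
    · exact absurd (add_eq_left.1 h) hc₀
  have hdich := n1_dichotomy π hπ hker hc₀ hB hU₀e₀ hU₀e₁ hU₁e₀ hU₁e₁ hcard hA h12 h13 h23 k12 k13 k23 hrel₁ hrel₂
    hp₁₀ hp₁₁ hsub
  -- the projected sets
  set V₀ := U₀.image π with hV₀
  set V₁ := U₁.image π with hV₁
  set X := (U₀ ∪ U₀.image (· + e₀)).image π with hX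
  set C := (U₁ ∪ U₁.image (· + e₀)).image π with hC
  set X' := (U₀ ∪ U₀.image (· + e₁)).image π with hX'
  set C' := (U₁ ∪ U₁.image (· + e₁)).image π with hC'
  have eX : X = V₀ ∪ V₀.image (· + π e₀) := by rw [hX, image_union, image_pi_image_add]
  have eC : C = V₁ ∪ V₁.image (· + π e₀) := by rw [hC, image_union, image_pi_image_add]
  have eX' : X' = V₀ ∪ V₀.image (· + π e₁) := by rw [hX', image_union, image_pi_image_add]
  have eC' : C' = V₁ ∪ V₁.image (· + π e₁) := by rw [hC', image_union, image_pi_image_add]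
  have cX : X.card = U₀.card := by
    have h := two_mul_card_image_pi π hker hc₀ hp₀₀; rw [← hX, card_pair_union hU₀e₀] at h; omega
  have cC : C.card = U₁.card := by
    have h := two_mul_card_image_pi π hker hc₀ hp₀₁; rw [← hC, card_pair_union hU₁e₀] at h; omega
  have cX' : X'.card = U₀.card := by
    have h := two_mul_card_image_pi π hker hc₀ hp₁₀; rw [← hX', card_pair_union hU₀e₁] at h; omega
  have cC' : C'.card = U₁.card := by
    have h := two_mul_card_image_pi π hker hc₀ hp₁₁; rw [← hC', card_pair_union hU₁e₁] at h; omega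
  -- (F) projected: `C' + ȳ ⊆ X'`
  have hF : C'.image (· + π y) ⊆ X' := by
    rw [hC', ← image_pi_image_add, pair_translate, hX']
    exact image_subset_image hsub
  -- Step 1: a common translation `ε`
  have step : ∃ ε : B, X' = X.image (· + ε) ∧ C' = C.image (· + ε) ∧
      X.image (· + (π e₁ - π e₀ - (ε + ε))) = X := by
    rcases hdich with h0 | h1 | heq | hneg
    · -- `π e₀ = 0`
      have hX0 : X = V₀ := by rw [eX, h0, image_add_zero', union_idempotent]
      have hC0 : C = V₁ := by rw [eC, h0, image_add_zero', union_idempotent]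
      have hX'0 : X' = V₀ := (eq_of_subset_of_card_le (by rw [eX']; exact subset_union_left)
        (by rw [cX', ← cX, hX0])).symm
      have hC'0 : C' = V₁ := (eq_of_subset_of_card_le (by rw [eC']; exact subset_union_left)
        (by rw [cC', ← cC, hC0])).symm
      have hstab : V₀.image (· + π e₁) = V₀ := by
        apply eq_of_subset_of_card_le _ (by rw [card_image_of_injective _ (add_left_injective _)])
        have h : V₀.image (· + π e₁) ⊆ X' := by rw [eX']; exact subset_union_right
        rwa [hX'0] at h
      refine ⟨0, by rw [image_add_zero', hX'0, hX0], by rw [image_add_zero', hC'0, hC0], ?_⟩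
      rw [h0, sub_zero, add_zero, sub_zero, hX0, hstab]
    · -- `π e₁ = 0`
      have hX'0 : X' = V₀ := by rw [eX', h1, image_add_zero', union_idempotent]
      have hC'0 : C' = V₁ := by rw [eC', h1, image_add_zero', union_idempotent]
      have hX0 : X = V₀ := (eq_of_subset_of_card_le (by rw [eX]; exact subset_union_left)
        (by rw [cX, ← cX', hX'0])).symm
      have hC0 : C = V₁ := (eq_of_subset_of_card_le (by rw [eC]; exact subset_union_left)
        (by rw [cC, ← cC', hC'0])).symm
      have hstab : V₀.image (· + π e₀) = V₀ := by
        apply eq_of_subset_of_card_le _ (by rw [card_image_of_injective _ (add_left_injective _)])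
        have h : V₀.image (· + π e₀) ⊆ X := by rw [eX]; exact subset_union_right
        rwa [hX0] at h
      have hstab' : V₀.image (· + -π e₀) = V₀ := by
        nth_rewrite 1 [← hstab]; rw [image_add_image, add_neg_cancel, image_add_zero']
      refine ⟨0, by rw [image_add_zero', hX'0, hX0], by rw [image_add_zero', hC'0, hC0], ?_⟩
      rw [h1, zero_sub, add_zero, sub_zero, hX0, hstab']
    · -- `π e₁ = π e₀`
      refine ⟨0, by rw [image_add_zero', eX', eX, heq], by rw [image_add_zero', eC', eC, heq], ?_⟩
      rw [heq, sub_self, add_zero, sub_zero, image_add_zero']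
    · -- `π e₁ = -π e₀`
      refine ⟨-π e₀, ?_, ?_, ?_⟩
      · rw [eX', eX, hneg, image_union, image_add_image, add_neg_cancel, image_add_zero', union_comm]
      · rw [eC', eC, hneg, image_union, image_add_image, add_neg_cancel, image_add_zero', union_comm]
      · rw [hneg, show -π e₀ - π e₀ - (-π e₀ + -π e₀) = 0 by abel, image_add_zero']
  obtain ⟨ε, hXε, hCε, hstab⟩ := step
  -- Step 2: the near-tiling `P ⊔ (P + e) ⊔ Cf = B`
  set P := X.image (· + π α₁) with hP
  set Cf := C.image (· + π α₂) with hCf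
  set e := π α₃ + ε - π α₁ with he
  have hPe' : P.image (· + e) = X'.image (· + π α₃) := by
    rw [hP, hXε, image_add_image, image_add_image]
    exact image_congr fun x _ => by rw [he]; abel
  -- the three (T1) pieces project to `P`, `Cf`, `P + e`
  have per₁ : (U₀.image (· + α₁) ∪ U₀.image (· + (α₁ + e₀))).image (· + c₀) =
      U₀.image (· + α₁) ∪ U₀.image (· + (α₁ + e₀)) := by
    rw [← pair_translate]; exact periodic_translate hp₀₀ α₁
  have per₂ : (U₁.image (· + α₂) ∪ U₁.image (· + (α₂ + e₀))).image (· + c₀) =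
      U₁.image (· + α₂) ∪ U₁.image (· + (α₂ + e₀)) := by
    rw [← pair_translate]; exact periodic_translate hp₀₁ α₂
  have per₃ : (U₀.image (· + α₃) ∪ U₀.image (· + (α₃ + e₁))).image (· + c₀) =
      U₀.image (· + α₃) ∪ U₀.image (· + (α₃ + e₁)) := by
    rw [← pair_translate]; exact periodic_translate hp₁₀ α₃
  have im₁ : (U₀.image (· + α₁) ∪ U₀.image (· + (α₁ + e₀))).image π = P := by
    rw [← pair_translate, image_pi_image_add, ← hX]
  have im₂ : (U₁.image (· + α₂) ∪ U₁.image (· + (α₂ + e₀))).image π = Cf := by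
    rw [← pair_translate, image_pi_image_add, ← hC]
  have im₃ : (U₀.image (· + α₃) ∪ U₀.image (· + (α₃ + e₁))).image π = P.image (· + e) := by
    rw [← pair_translate, image_pi_image_add, ← hX', hPe']
  have dPC : Disjoint P Cf := by rw [← im₁, ← im₂]; exact disjoint_image_pi π hker per₂ h12
  have dPPe : Disjoint P (P.image (· + e)) := by rw [← im₃, ← im₁]; exact disjoint_image_pi π hker per₃ h13
  have dPeC : Disjoint (P.image (· + e)) Cf := by
    rw [← im₃, ← im₂]; exact (disjoint_image_pi π hker per₃ h23).symm
  have cP : P.card = U₀.card := by rw [hP, card_image_of_injective _ (add_left_injective _), cX]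
  have cCf : Cf.card = U₁.card := by rw [hCf, card_image_of_injective _ (add_left_injective _), cC]
  have cB : Fintype.card B = 2 * U₀.card + U₁.card := by
    have h := two_mul_card_quot π hker hc₀
    rw [image_pi_univ π hπ, card_univ] at h; omega
  -- `Cf ⊆ P + 2e`
  have hsub2 : Cf ⊆ P.image (· + (e + e)) := by
    intro x hx
    rw [hCf] at hx
    obtain ⟨c, hc, rfl⟩ := mem_image.1 hx
    have hc' : c + ε + π y ∈ X.image (· + ε) := by
      rw [← hXε]; apply hF; rw [hCε, image_add_image]; exact mem_image.2 ⟨c, hc, by abel⟩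
    obtain ⟨x₀, hx₀, hx₀e⟩ := mem_image.1 hc'
    have hx₀' : x₀ + (π e₁ - π e₀ - (ε + ε)) ∈ X := by rw [← hstab]; exact mem_image_of_mem _ hx₀
    rw [hP, image_add_image]
    refine mem_image.2 ⟨_, hx₀', ?_⟩
    have hy : π y = π α₁ + π α₂ - π α₃ - π α₃ + π e₀ - π e₁ := by
      rw [hrel₃]; simp only [map_add, map_sub, hπc, add_zero]
    have : c = x₀ + ε - π y - ε := by rw [hx₀e]; abel
    rw [this, hy, he]; abel
  obtain ⟨a, b, hab⟩ := two_cosets_of_three_pieces dPC dPPe dPeC (by rw [cP, cCf, cB]; ring)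
    (by rw [cP, cCf, hcard]) hsub2
  -- Step 3: pull the two cosets of `⟨e⟩` back to four cosets in `A`
  obtain ⟨g, hg⟩ := hπ e
  obtain ⟨za, hza⟩ := hπ a
  obtain ⟨zb, hzb⟩ := hπ b
  refine ⟨g, zb - za, fun x => ?_⟩
  have lift : ∀ w : A, π w ∈ AddSubgroup.zmultiples e →
      w ∈ AddSubgroup.zmultiples g ∨ w + c₀ ∈ AddSubgroup.zmultiples g := by
    intro w hw
    obtain ⟨n, hn⟩ := AddSubgroup.mem_zmultiples_iff.1 hw
    rcases (hker (w - n • g)).1 (by rw [map_sub, map_zsmul, hg, hn, sub_self]) with h | h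
    · exact Or.inl (AddSubgroup.mem_zmultiples_iff.2 ⟨n, (sub_eq_zero.1 h).symm⟩)
    · right
      refine AddSubgroup.mem_zmultiples_iff.2 ⟨n, ?_⟩
      calc n • g = w - (w - n • g) := by abel
        _ = w - c₀ := by rw [h]
        _ = w + c₀ := by rw [sub_eq_add_neg, neg_eq_of_add_eq_zero_right h2c]
  rcases hab (π (x + za)) with h | h
  · have h' : π x ∈ AddSubgroup.zmultiples e := by rwa [map_add, hza, add_sub_cancel_right] at h
    rcases lift x h' with h1 | h1
    · exact Or.inl h1
    · exact Or.inr (Or.inr (Or.inl h1))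
  · have h' : π (x - (zb - za)) ∈ AddSubgroup.zmultiples e := by
      have : π (x - (zb - za)) = π (x + za) - b := by rw [map_sub, map_sub, map_add, hza, hzb]; abel
      rwa [this]
    rcases lift _ h' with h1 | h1
    · exact Or.inr (Or.inl h1)
    · right; right; right
      have : x + c₀ - (zb - za) = x - (zb - za) + c₀ := by abel
      rwa [this]

end N1Cosets

end Summit.MatrixMultiplication.OmegaCensus
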